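import Mathlib.Combinatorics.SetFamily.FourFunctions
import Mathlib.Data.Finset.SymmDiff
import Mathlib.Tactic
import HarnessLib
import HarnessLib.Audit.Tags

/-!
# Equality in the Marica–Schönheim inequality, I: symmetric-difference witnesses

Support file (seat `prim-masterthm-p1`, gen 29; `--supports stmt-CriticalPhenomena-4575`).  No `sorry`, standard axioms.
Memo `run/shared/lean/prim/prim-masterthm/FROM-prim-masterthm-p1-g29-MS-EQUALITY.md`.

CONTEXT.  Gen 28 reduced the singleton-class case of the crossing signed coloured Daykin inequality (`CrossSignedColouredDaykin3`, the
statement the three-petal refined Gladkov count needs) to the conjecture `StrictMaricaSchonheim` (tree `…SahiColouredDaykinCrossSingleton`):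
the Marica–Schönheim inequality `#Q ≤ #(Q \\ Q)` is strict whenever the comparability graph of `Q` is disconnected.  Gen 29 proves it by
characterising the cases of EQUALITY (an Aharoni–Holzman-type theorem, reconstructed independently; the 1993 paper is not held):

  `#(Q \\ Q) = #Q`  iff  there is a set `M` with `Q \\ Q = {C △ M : C ∈ Q}`  (a *witness*; then `M ∈ Q` and `C ∪ M ∈ Q` for all `C ∈ Q`,
  so the comparability graph is connected).

THIS FILE: the witness predicate `IsWitness Q M` and its algebra (Lemma 1 of the memo): `M ∈ Q`; `C ∪ M, C ∩ M ∈ Q`; the EXCHANGE property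
`(y ∩ M) ∪ (x \ M) ∈ Q`; closure of `M`-parts under `∪`, of outer parts and co-`M`-parts under `\`, `∩`; closure of `Q \\ Q` under `∩` and `\`;
and the TRANSFER LEMMA (memo Lemma 2): if `h \ t` and `t \ l` are differences of `T` for every `t ∈ T`, then so is `h \ l`. [this work]
-/

namespace Summit.CriticalPhenomena.PercolationContinuityZ3.Theorems.SahiMSEquality

open Finset
open scoped FinsetFamily symmDiff

variable {α : Type*} [DecidableEq α]

/-! ### 1. Witnesses -/

/-- `M` is a **witness** for the family `Q`: the difference family `Q \\ Q` is the translate `{C △ M : C ∈ Q}`. [this work] -/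
structure IsWitness (Q : Finset (Finset α)) (M : Finset α) : Prop where
  /-- the difference family is the translate of the family by `M` -/
  eq : Q \\ Q = Q.image (· ∆ M)

namespace IsWitness

variable {Q : Finset (Finset α)} {M : Finset α}

/-- Membership in the difference family of a witnessed family. [this work] -/
theorem mem_diffs_iff (hW : IsWitness Q M) {X : Finset α} : X ∈ Q \\ Q ↔ ∃ C ∈ Q, C ∆ M = X := by
  rw [hW.eq, mem_image]

/-- A witnessed family attains equality in the Marica–Schönheim inequality. [this work] -/
theorem card_diffs (hW : IsWitness Q M) : #(Q \\ Q) = #Q := by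
  rw [hW.eq]
  exact card_image_of_injective _ (symmDiff_left_injective M)

/-- For `A, B ∈ Q` the set `(A \ B) △ M` is a member. [this work] -/
theorem sdiff_symmDiff_mem (hW : IsWitness Q M) {A B : Finset α} (hA : A ∈ Q) (hB : B ∈ Q) : (A \ B) ∆ M ∈ Q := by
  obtain ⟨C, hC, hCX⟩ := (hW.mem_diffs_iff).1 (sdiff_mem_diffs hA hB)
  have : C = (A \ B) ∆ M := by rw [← hCX, symmDiff_symmDiff_cancel_right]
  rw [← this]; exact hC

/-- Conversely every member is `(A \ B) △ M`; in the form: `C ∈ Q → C △ M ∈ Q \\ Q`. [this work] -/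
theorem symmDiff_mem_diffs (hW : IsWitness Q M) {C : Finset α} (hC : C ∈ Q) : C ∆ M ∈ Q \\ Q :=
  (hW.mem_diffs_iff).2 ⟨C, hC, rfl⟩

/-- The witness is a member (if `Q` is non-empty). [this work] -/
theorem mem (hW : IsWitness Q M) (hQ : Q.Nonempty) : M ∈ Q := by
  obtain ⟨A, hA⟩ := hQ
  have h := hW.sdiff_symmDiff_mem hA hA
  have e : (A \ A) ∆ M = M := by
    ext x; simp only [mem_symmDiff, mem_sdiff]; tauto
  rwa [e] at h

/-- `C ∪ M ∈ Q` for every member `C`. [this work] -/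
theorem union_mem (hW : IsWitness Q M) {C : Finset α} (hC : C ∈ Q) : C ∪ M ∈ Q := by
  have h := hW.sdiff_symmDiff_mem hC (hW.mem ⟨C, hC⟩)
  have e : (C \ M) ∆ M = C ∪ M := by
    ext x; simp only [mem_symmDiff, mem_sdiff, mem_union]; tauto
  rwa [e] at h

/-- `C ∩ M ∈ Q` for every member `C`. [this work] -/
theorem inter_mem (hW : IsWitness Q M) {C : Finset α} (hC : C ∈ Q) : C ∩ M ∈ Q := by
  have h := hW.sdiff_symmDiff_mem (hW.mem ⟨C, hC⟩) hC
  have e : (M \ C) ∆ M = C ∩ M := by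
    ext x; simp only [mem_symmDiff, mem_sdiff, mem_inter]; tauto
  rwa [e] at h

/-- The member `(a \ b) △ M` has `M`-part `(M \ a) ∪ (b ∩ M)` and outer part `(a \ M) \ (b \ M)`. [this work] -/
theorem parts_sdiff_symmDiff (M a b : Finset α) :
    ((a \ b) ∆ M) ∩ M = (M \ a) ∪ (b ∩ M) ∧ ((a \ b) ∆ M) \ M = (a \ M) \ (b \ M) := by
  constructor
  · ext x; simp only [mem_inter, mem_symmDiff, mem_sdiff, mem_union]; tauto
  · ext x; simp only [mem_symmDiff, mem_sdiff]; tauto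

/-- **Exchange.** For members `x, y`, the set with the `M`-part of `y` and the outer part of `x` is a member. [this work] -/
theorem exchange (hW : IsWitness Q M) {x y : Finset α} (hx : x ∈ Q) (hy : y ∈ Q) : (y ∩ M) ∪ (x \ M) ∈ Q := by
  have h := hW.sdiff_symmDiff_mem (hW.union_mem hx) (hW.inter_mem hy)
  have e : ((x ∪ M) \ (y ∩ M)) ∆ M = (y ∩ M) ∪ (x \ M) := by
    ext z; simp only [mem_symmDiff, mem_sdiff, mem_union, mem_inter]; tauto
  rwa [e] at h

/-- **Assembling a member from parts.** If `w` has the `M`-part of a member and the outer part of a member then `w ∈ Q`. [this work] -/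
theorem mem_of_parts (hW : IsWitness Q M) {w z₁ z₂ : Finset α} (hz₁ : z₁ ∈ Q) (hz₂ : z₂ ∈ Q)
    (hU : w ∩ M = z₁ ∩ M) (hD : w \ M = z₂ \ M) : w ∈ Q := by
  have h := hW.exchange hz₂ hz₁
  have e : (z₁ ∩ M) ∪ (z₂ \ M) = w := by
    rw [← hU, ← hD]; ext x; simp only [mem_union, mem_inter, mem_sdiff]; tauto
  rwa [e] at h

/-- Outer parts are closed under `\`: some member has outer part `(x \ M) \ (y \ M)`. [this work] -/
theorem exists_sdiff_eq_sdiff (hW : IsWitness Q M) {x y : Finset α} (hx : x ∈ Q) (hy : y ∈ Q) :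
    ∃ z ∈ Q, z \ M = (x \ M) \ (y \ M) :=
  ⟨(x \ y) ∆ M, hW.sdiff_symmDiff_mem hx hy, (parts_sdiff_symmDiff M x y).2⟩

/-- Outer parts are closed under `∩`. [this work] -/
theorem exists_sdiff_eq_inter (hW : IsWitness Q M) {x y : Finset α} (hx : x ∈ Q) (hy : y ∈ Q) :
    ∃ z ∈ Q, z \ M = (x \ M) ∩ (y \ M) := by
  obtain ⟨c, hc, hcD⟩ := hW.exists_sdiff_eq_sdiff hx hy
  obtain ⟨z, hz, hzD⟩ := hW.exists_sdiff_eq_sdiff hx hc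
  refine ⟨z, hz, ?_⟩
  rw [hzD, hcD]
  ext a; simp only [mem_sdiff, mem_inter]; tauto

/-- Co-`M`-parts are closed under `\`: some member has `M`-part `(M \ x) ∪ (y ∩ M)` (= `M` minus `(x ∩ M) \ (y ∩ M)`). [this work] -/
theorem exists_inter_eq_compl_sdiff (hW : IsWitness Q M) {x y : Finset α} (hx : x ∈ Q) (hy : y ∈ Q) :
    ∃ z ∈ Q, z ∩ M = (M \ x) ∪ (y ∩ M) :=
  ⟨(x \ y) ∆ M, hW.sdiff_symmDiff_mem hx hy, (parts_sdiff_symmDiff M x y).1⟩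

/-- `M`-parts are closed under `∪`. [this work] -/
theorem exists_inter_eq_union (hW : IsWitness Q M) {x y : Finset α} (hx : x ∈ Q) (hy : y ∈ Q) :
    ∃ z ∈ Q, z ∩ M = (x ∩ M) ∪ (y ∩ M) := by
  -- z₁ := (y \ x) △ M has M-part (M \ y) ∪ (x ∩ M); then (z₁ \ x) △ M has M-part (M \ z₁) ∪ (x ∩ M) = (y ∩ M) \ … ∪ (x ∩ M)
  obtain ⟨z₁, hz₁, hz₁U⟩ := hW.exists_inter_eq_compl_sdiff hy hx
  obtain ⟨z, hz, hzU⟩ := hW.exists_inter_eq_compl_sdiff hz₁ hx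
  refine ⟨z, hz, ?_⟩
  rw [hzU]
  ext a
  have h1 : a ∈ z₁ ∩ M ↔ a ∈ (M \ y) ∪ (x ∩ M) := by rw [hz₁U]
  simp only [mem_inter, mem_sdiff, mem_union] at h1 ⊢
  tauto

/-- Co-`M`-parts are closed under `∩`: some member has `M`-part `(x ∩ M) ∪ (y ∩ M)`… dual form: `M`-part `M \ ((M \ x) ∩ (M \ y))`
is the union; we record the genuinely new one: `M`-part `(x ∩ M) ∩ (y ∩ M) ∪ …` is NOT claimed.  Instead: some member has `M`-part
`M \ (((x ∩ M) \ (y ∩ M)) ∩ ((x' ∩ M) \ (y' ∩ M)))` is derivable; we only need the following special case: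
some member has `M`-part `(M \ x) ∪ (M \ x') ∪ (y ∩ M)`. [this work] -/
theorem exists_inter_eq_compl_inter (hW : IsWitness Q M) {x x' y : Finset α} (hx : x ∈ Q) (hx' : x' ∈ Q) (hy : y ∈ Q) :
    ∃ z ∈ Q, z ∩ M = (M \ x) ∪ (M \ x') ∪ (y ∩ M) := by
  -- w := member with M-part (x ∩ M) ∩ ... we use: co-part of target = (x ∩ x' ∩ M) \ (y ∩ M); take u with U_u = U_x ∩ U_{x'}:
  -- U_x ∩ U_{x'} = M \ ((M \ x) ∪ (M \ x')) and (M\x) ∪ (M\x') is the M-part of ... hmm; we go through inter_mem instead: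
  -- x ∩ x' need not be a member, but (x ∩ M) ∩ x' ... use: z₀ with U = M \ ((M\x') ∪ (x∩M))? Simplest: apply compl_sdiff twice.
  obtain ⟨z₁, hz₁, hz₁U⟩ := hW.exists_inter_eq_compl_sdiff hx hy      -- U_{z₁} = (M \ x) ∪ (y ∩ M)
  obtain ⟨z₂, hz₂, hz₂U⟩ := hW.exists_inter_eq_compl_sdiff hx' hz₁   -- U_{z₂} = (M \ x') ∪ (z₁ ∩ M)
  refine ⟨z₂, hz₂, ?_⟩
  rw [hz₂U, hz₁U]
  ext a; simp only [mem_union, mem_sdiff, mem_inter]; tauto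

/-! ### 2. The difference family of a witnessed family is closed under `∩` and `\` -/

/-- `Q \\ Q` is closed under intersection. [this work] -/
theorem inter_mem_diffs (hW : IsWitness Q M) {X Y : Finset α} (hX : X ∈ Q \\ Q) (hY : Y ∈ Q \\ Q) : X ∩ Y ∈ Q \\ Q := by
  obtain ⟨x, hx, rfl⟩ := hW.mem_diffs_iff.1 hX
  obtain ⟨y, hy, rfl⟩ := hW.mem_diffs_iff.1 hY
  -- (x △ M) ∩ (y △ M) = z △ M with z ∩ M = (x ∪ y) ∩ M, z \ M = (x ∩ y) \ M
  obtain ⟨z₁, hz₁, hz₁U⟩ := hW.exists_inter_eq_union hx hy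
  obtain ⟨z₂, hz₂, hz₂D⟩ := hW.exists_sdiff_eq_inter hx hy
  set z : Finset α := ((x ∩ M) ∪ (y ∩ M)) ∪ ((x \ M) ∩ (y \ M)) with hzdef
  have hzU : z ∩ M = z₁ ∩ M := by
    rw [hz₁U, hzdef]; ext a; simp only [mem_inter, mem_union, mem_sdiff]; tauto
  have hzD : z \ M = z₂ \ M := by
    rw [hz₂D, hzdef]; ext a; simp only [mem_inter, mem_union, mem_sdiff]; tauto
  have hz : z ∈ Q := hW.mem_of_parts hz₁ hz₂ hzU hzD
  have e : (x ∆ M) ∩ (y ∆ M) = z ∆ M := by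
    rw [hzdef]; ext a; simp only [mem_inter, mem_symmDiff, mem_union, mem_sdiff]; tauto
  rw [e]; exact hW.symmDiff_mem_diffs hz

/-- `Q \\ Q` is closed under difference. [this work] -/
theorem sdiff_mem_diffs' (hW : IsWitness Q M) {X Y : Finset α} (hX : X ∈ Q \\ Q) (hY : Y ∈ Q \\ Q) : X \ Y ∈ Q \\ Q := by
  obtain ⟨x, hx, rfl⟩ := hW.mem_diffs_iff.1 hX
  obtain ⟨y, hy, rfl⟩ := hW.mem_diffs_iff.1 hY
  -- (x △ M) \ (y △ M) = w △ M with w ∩ M = (M \ y) ∪ (x ∩ M), w \ M = (x \ M) \ (y \ M)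
  obtain ⟨z₁, hz₁, hz₁U⟩ := hW.exists_inter_eq_compl_sdiff hy hx
  obtain ⟨z₂, hz₂, hz₂D⟩ := hW.exists_sdiff_eq_sdiff hx hy
  set w : Finset α := ((M \ y) ∪ (x ∩ M)) ∪ ((x \ M) \ (y \ M)) with hwdef
  have hwU : w ∩ M = z₁ ∩ M := by
    rw [hz₁U, hwdef]; ext a; simp only [mem_inter, mem_union, mem_sdiff]; tauto
  have hwD : w \ M = z₂ \ M := by
    rw [hz₂D, hwdef]; ext a; simp only [mem_inter, mem_union, mem_sdiff]; tauto
  have hw : w ∈ Q := hW.mem_of_parts hz₁ hz₂ hwU hwD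
  have e : (x ∆ M) \ (y ∆ M) = w ∆ M := by
    rw [hwdef]; ext a; simp only [mem_inter, mem_symmDiff, mem_union, mem_sdiff]; tauto
  rw [e]; exact hW.symmDiff_mem_diffs hw

/-! ### 3. The transfer lemma -/

/-- **Transfer lemma.**  If `T` has a witness and `h \ t`, `t \ l` are differences of `T` for every `t ∈ T`, then `h \ l` is a
difference of `T`.  (Proof: `h ∪ M, M ∩ l ∈ T`; `h \ l = (h \ (M ∩ l)) ∩ ((h ∪ M) \ l)`; closure under `∩`.) [this work] -/
theorem sdiff_mem_diffs_of_forall (hW : IsWitness Q M) (hQ : Q.Nonempty) {h l : Finset α}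
    (hh : ∀ t ∈ Q, h \ t ∈ Q \\ Q) (hl : ∀ t ∈ Q, t \ l ∈ Q \\ Q) : h \ l ∈ Q \\ Q := by
  have hM : M ∈ Q := hW.mem hQ
  -- t₁ := (h \ M) △ M = h ∪ M ∈ Q
  obtain ⟨c₁, hc₁, hc₁e⟩ := hW.mem_diffs_iff.1 (hh M hM)
  have ht₁ : h ∪ M ∈ Q := by
    have : c₁ = (h \ M) ∆ M := by rw [← hc₁e, symmDiff_symmDiff_cancel_right]
    have e : (h \ M) ∆ M = h ∪ M := by
      ext x; simp only [mem_symmDiff, mem_sdiff, mem_union]; tauto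
    rw [← e, ← this]; exact hc₁
  -- t₂ := (M \ l) △ M = M ∩ l ∈ Q
  obtain ⟨c₂, hc₂, hc₂e⟩ := hW.mem_diffs_iff.1 (hl M hM)
  have ht₂ : M ∩ l ∈ Q := by
    have : c₂ = (M \ l) ∆ M := by rw [← hc₂e, symmDiff_symmDiff_cancel_right]
    have e : (M \ l) ∆ M = M ∩ l := by
      ext x; simp only [mem_symmDiff, mem_sdiff, mem_inter]; tauto
    rw [← e, ← this]; exact hc₂
  have hX := hh _ ht₂
  have hY := hl _ ht₁
  have e : (h \ (M ∩ l)) ∩ ((h ∪ M) \ l) = h \ l := by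
    ext x; simp only [mem_inter, mem_sdiff, mem_union]; tauto
  rw [← e]
  exact hW.inter_mem_diffs hX hY

end IsWitness

/-- A family whose translate by `M` lies inside its difference family, with `#(Q \\ Q) = #Q`, is witnessed by `M`. [this work] -/
theorem isWitness_of_image_subset {Q : Finset (Finset α)} {M : Finset α}
    (hsub : Q.image (· ∆ M) ⊆ Q \\ Q) (hcard : #(Q \\ Q) = #Q) : IsWitness Q M := by
  refine ⟨?_⟩
  symm
  apply eq_of_subset_of_card_le hsub
  rw [hcard, card_image_of_injective _ (symmDiff_left_injective M)]

/-- A witnessed non-empty family is star-shaped around its witness: `M ∈ Q` and `C ∪ M ∈ Q` for all members `C`; in particular its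
comparability graph is connected. [this work] -/
theorem exists_hub_of_isWitness {Q : Finset (Finset α)} {M : Finset α} (hW : IsWitness Q M) (hQ : Q.Nonempty) :
    M ∈ Q ∧ ∀ C ∈ Q, C ∪ M ∈ Q ∧ C ∩ M ∈ Q :=
  ⟨hW.mem hQ, fun _ hC => ⟨hW.union_mem hC, hW.inter_mem hC⟩⟩

end Summit.CriticalPhenomena.PercolationContinuityZ3.Theorems.SahiMSEquality
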